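import Summits.QuantumAdvantage.QuantumAdvantage.Theorems.CubicForrelationNearExactIsExactTwelveLevelFive930Dead
import Summits.QuantumAdvantage.QuantumAdvantage.Theorems.CubicForrelationNearExactIsExactTwelveTypeO960Partner
import Summits.QuantumAdvantage.QuantumAdvantage.Theorems.CubicForrelationNearExactIsExactKtThreeStructure

/-!
# Crux `CubicForrelation.NearExactIsExact` (stmt-QuantumAdvantage-14043) — n = 12: NO type-O side at `Φ ≥ 930/1024`
  (the zero-excess base-`992` configuration "T0" is dead: its partner is a level-5 side)

Certificate seat `b2b-cforr-cert` (gen 20).  HONEST FRAMING: a kernel-checked THEOREM (standard axioms) about cubic Boolean pairs on 12 bits — the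
second of the three configurations of the value `930/1024` on the `n = 12` ladder (level 5: …TwelveLevelFive930Dead; remaining: level `≥ 6` ×
level `≥ 6` at `Σ e² = 752`).  It does NOT by itself produce a new value of `θ₁₂`.  NOT summit progress.

THEOREM `to20_typeO_ge930_false`: cubic `f, g` on 12 bits with `W_g = 16u`, some `u(x)` odd, `Φ(f,g) ≥ 930/1024` do not exist.  Proof (gen 19's
paper claim "T0 × L5", HOME/b2b-cforr-cert-g19/PLAN-N12-931-L6.md, now in Lean):
* `to19_typeO_ge930_shape`: `#E = 992` and `Σ (u − 4(−1)^f)² = 12032 = 4096 + 8·992` (zero excess), so pointwise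
  `u − 4(−1)^f = (−1)^{d₁}(1 − 4·1_E)` (`to20_typeO_E992_zero_excess`, verbatim gen 18's `to18_typeO_E960_zero_excess`);
* the partner identity (`to18_typeO_partner_identity` with `v = 0`): `16·u_f(y) = 64(−1)^{g(y)} − (−1)^{b₁}(1024·[y = c₁] − Ê(c₁ ⊕ y))`,
  `Ê(z) = Σ_{x∈E}(−1)^{x·z}`, `u_f = W_f/16`;
* `to20_char_sum_E992`: `Ê(0) = 992` and `32 ∣ Ê(z)` for `z ≠ 0` — `Ê(z) = 992 − 2A` where `A`, `992 − A` are weights of cubics on 11 bits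
  (`ktg_restrict`), the smaller one `< 512 = 2d`, hence by KASAMI–TOKURA FOR CUBICS (`kt3_weights_all`, gen 19's classification-free proof) of
  the form `512 − 2^i` (`i ≥ 4`) or `448` or `0`, all `≡ 0 (mod 16)` (`to20_cubic_weight_eleven_mod16`);
* hence `u_f` is even everywhere and `u_f(c₁)/2 = 2(−1)^{g} − (−1)^{b₁}·(32 − 31)` is odd: the partner `f` is a LEVEL-5 side of the pair
  `(g, f)` with `Φ(g,f) = Φ(f,g) ≥ 930/1024` — impossible by `tw20_levelFive_ge930_false`.

References: T. Kasami, N. Tokura (1970); J. Ax (1964) / R. J. McEliece (1972); MacWilliams–Sloane (1977) Ch. 13 §3, Ch. 15; C. Carlet (2021) §5.2.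
Everything below is proved from Mathlib and the tree; axioms are the standard three.
-/

set_option linter.dupNamespace false -- D-0017: single-problem summit ⇒ `QuantumAdvantage.QuantumAdvantage` by design

noncomputable section

namespace Summit.QuantumAdvantage.QuantumAdvantage.Theorems.CubicForrelation.NearExactIsExact

open Finset
open Literature.Computability.QuantumComplexity
open Literature.Computability.QuantumComplexity.BuzetChailloux (bxor zeroVec bxor_bxor_cancel_left bxor_zeroVec zeroVec_bxor bxor_comm
  bxor_self twist_zeroVec_right twist_bxor_right)
open Literature.Computability.QuantumComplexity.DerivativeWalsh (W)
open Literature.Computability.QuantumComplexity.Simon (twist_eq_one_or)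
open Summit.QuantumAdvantage.QuantumAdvantage.Theorems.NearExactIsExact.Negative (TypeOTwelve.typeO_of_exists_odd)

/-! ### Cubic weights on 11 bits below `512` are multiples of `16` (Kasami–Tokura for cubics) -/

/-- A cubic on 11 bits with fewer than `512` ones has a multiple of `16` of them (`0`, `256`, `384`, `448`, `480` or `496`) — from the tree's
classification-free `kt3_weights_all`. [cite: KasamiTokura1970, Thm 1] -/
theorem to20_cubic_weight_eleven_mod16 (e : (Fin 11 → Bool) → Bool) (he : IsDegLeFun 3 e)
    (h : #(univ.filter fun y => e y = true) < 512) : 16 ∣ #(univ.filter fun y => e y = true) := by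
  have hN : (2 : ℕ) ^ 11 = 2048 := by norm_num
  rcases kt3_weights_all e he (by rw [hN]; omega) with h0 | ⟨s, hs, hs2⟩ | hex
  · rw [h0]; exact dvd_zero _
  · rw [hN] at hs
    have hs6 : 6 ≤ s := by omega
    have hs11 : s ≤ 11 := by
      by_contra hlt
      push Not at hlt
      have : 2 ^ 12 ≤ 2 ^ s := Nat.pow_le_pow_right (by norm_num) hlt
      omega
    obtain ⟨i, rfl⟩ : ∃ i, s = i + 6 := ⟨s - 6, by omega⟩
    rw [pow_add] at hs
    have : #(univ.filter fun y => e y = true) = 512 - 16 * 2 ^ i := by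
      have h64 : (2 : ℕ) ^ 6 = 64 := by norm_num
      rw [h64] at hs
      omega
    rw [this]
    exact Nat.dvd_sub (⟨32, by norm_num⟩ : 16 ∣ 512) ⟨2 ^ i, rfl⟩
  · rw [hN] at hex
    have : #(univ.filter fun y => e y = true) = 448 := by omega
    rw [this]; norm_num

/-! ### Character sums of a weight-`992` cubic support -/

/-- **`32 ∣ Ê(z)` for `z ≠ 0`** when `E` is the support of a cubic on 12 bits with `#E = 992`: `Ê(z) = 992 − 2A` with `A`, `992 − A` cubic
weights on 11 bits, one of them `< 512`, hence `≡ 0 (mod 16)`. [this work] -/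
theorem to20_char_sum_E992 (c : (Fin (6 + 6) → Bool) → Bool) (hc : IsDegLeFun 3 c) (h992 : #(univ.filter fun x => c x = true) = 992)
    (z : Fin (6 + 6) → Bool) (i₀ : Fin (6 + 6)) (hz : z i₀ = true) :
    ∃ m : ℤ, ∑ x ∈ univ.filter (fun x => c x = true), twist x z = 32 * (m : ℝ) := by
  classical
  have htw : ∀ x : Fin (6 + 6) → Bool, twist x z =
      1 - 2 * (if decide (Odd #(univ.filter fun i => (x i && z i) = true)) = true then (1 : ℝ) else 0) := by
    intro x
    rw [vg_twist_eq_signOf x z]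
    unfold signOf
    cases decide (Odd #(univ.filter fun i => (x i && z i) = true)) <;> norm_num
  set A := #(univ.filter fun x : Fin (6 + 6) → Bool =>
    c x = true ∧ decide (Odd #(univ.filter fun i => (x i && z i) = true)) = true) with hAdef
  set B := #(univ.filter fun x : Fin (6 + 6) → Bool =>
    c x = true ∧ decide (Odd #(univ.filter fun i => (x i && z i) = true)) = false) with hBdef
  have hsum : ∑ x ∈ univ.filter (fun x => c x = true), twist x z = 992 - 2 * (A : ℝ) := by
    rw [sum_congr rfl fun x _ => htw x, sum_sub_distrib, sum_const, h992, ← mul_sum, sum_boole, filter_filter, ← hAdef]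
    norm_num
  have hAB : A + B = 992 := by
    have h := card_filter_add_card_filter_not (s := univ.filter fun x : Fin (6 + 6) → Bool => c x = true)
      (fun x => decide (Odd #(univ.filter fun i => (x i && z i) = true)) = true)
    rw [filter_filter, filter_filter, h992] at h
    have e : (univ.filter fun x : Fin (6 + 6) → Bool =>
        c x = true ∧ ¬ decide (Odd #(univ.filter fun i => (x i && z i) = true)) = true) =
        univ.filter fun x : Fin (6 + 6) → Bool =>
          c x = true ∧ decide (Odd #(univ.filter fun i => (x i && z i) = true)) = false :=
      filter_congr fun x _ => by simp only [Bool.not_eq_true]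
    rw [e] at h
    exact h
  obtain ⟨cT, hcT, hcardT⟩ := ktg_restrict (k := 11) c hc z i₀ hz true
  obtain ⟨cF, hcF, hcardF⟩ := ktg_restrict (k := 11) c hc z i₀ hz false
  have h16A : 16 ∣ A := by
    by_cases hA : A < 512
    · have h := to20_cubic_weight_eleven_mod16 cT hcT (by rw [hcardT]; exact hA)
      rw [hcardT] at h; exact h
    · have hB : B < 512 := by omega
      have h := to20_cubic_weight_eleven_mod16 cF hcF (by rw [hcardF]; exact hB)
      rw [hcardF] at h
      change 16 ∣ B at h
      have : A = 992 - B := by omega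
      rw [this]
      exact Nat.dvd_sub ⟨62, by norm_num⟩ h
  obtain ⟨k, hk⟩ := h16A
  refine ⟨31 - k, ?_⟩
  rw [hsum, hk]
  push_cast
  ring

/-! ### Zero excess with base set `992` -/

/-- **Zero excess, base `992`**: if `#E = 992` and `Σ (u − 4(−1)^f)² = 12032` then `u − 4(−1)^f = (−1)^{d₁}(1 − 4·1_E)` pointwise (VERBATIM
`to18_typeO_E960_zero_excess` with the numbers `992 / 12032`). [this work] -/
theorem to20_typeO_E992_zero_excess (f g : (Fin (6 + 6) → Bool) → Bool) (hg : IsDegLeFun 3 g)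
    (u : (Fin (6 + 6) → Bool) → ℤ) (hu : ∀ x, W (fun y => signOf (g y)) x = (2 : ℝ) ^ 4 * (u x : ℝ))
    (hodd : ∃ x, Odd (u x)) (hE : #(univ.filter fun x : Fin (6 + 6) → Bool => (Odd (u x / 2) ↔ Odd (u x / 2 / 2))) = 992)
    (hT : (∑ x, (u x - 4 * sZ (f x)) ^ 2 : ℤ) = 12032) :
    ∀ x, u x - 4 * sZ (f x) = sZ (decide (Odd (u x / 2))) * (1 - 4 * (if (Odd (u x / 2) ↔ Odd (u x / 2 / 2)) then 1 else 0)) := by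
  classical
  have hall : ∀ x, Odd (u x) := TypeOTwelve.typeO_of_exists_odd g u hg hu hodd
  set E := univ.filter (fun x : Fin (6 + 6) → Bool => (Odd (u x / 2) ↔ Odd (u x / 2 / 2))) with hEdef
  have hsumE : (∑ x, (if (Odd (u x / 2) ↔ Odd (u x / 2 / 2)) then 1 else 0 : ℤ)) = #E := by rw [sum_boole]
  choose v hv using fun x => to12_pt_mod8 (u x) (sZ (f x)) (hall x) (tp_sZ_cases (f x))
  set τ₀ : (Fin (6 + 6) → Bool) → ℤ := fun x =>
    sZ (decide (Odd (u x / 2))) * (1 - 4 * (if (Odd (u x / 2) ↔ Odd (u x / 2 / 2)) then 1 else 0)) with hτ₀def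
  have hτ₀val : ∀ x, τ₀ x = 1 ∨ τ₀ x = -1 ∨ τ₀ x = 3 ∨ τ₀ x = -3 := by
    intro x
    simp only [τ₀]
    rcases tp_sZ_cases (decide (Odd (u x / 2))) with h | h <;> rw [h] <;> split_ifs <;> norm_num
  have hτ₀sq : ∀ x, τ₀ x ^ 2 = 1 + 8 * (if (Odd (u x / 2) ↔ Odd (u x / 2 / 2)) then 1 else 0 : ℤ) := by
    intro x
    simp only [τ₀]
    rcases tp_sZ_cases (decide (Odd (u x / 2))) with h | h <;> rw [h] <;> split_ifs <;> norm_num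
  have hsumτ₀ : ∑ x, τ₀ x ^ 2 = 12032 := by
    rw [sum_congr rfl fun x _ => hτ₀sq x, sum_add_distrib, ← mul_sum, hsumE, sum_const, card_univ, Fintype.card_fun,
      Fintype.card_bool, Fintype.card_fin]
    change (4096 : ℕ) • (1 : ℤ) + 8 * ((#E : ℕ) : ℤ) = 12032
    rw [hE]; norm_num
  have hXnn : ∀ x, 0 ≤ (τ₀ x + 8 * v x) ^ 2 - τ₀ x ^ 2 := fun x => to12_excess_nonneg _ _ (hτ₀val x)
  have hTdec : (∑ x, (u x - 4 * sZ (f x)) ^ 2 : ℤ) = ∑ x, τ₀ x ^ 2 + ∑ x, ((τ₀ x + 8 * v x) ^ 2 - τ₀ x ^ 2) := by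
    rw [← sum_add_distrib]
    exact sum_congr rfl fun x _ => by rw [hv x]; ring
  have hXsum0 : ∑ x, ((τ₀ x + 8 * v x) ^ 2 - τ₀ x ^ 2) = 0 := by
    apply le_antisymm _ (sum_nonneg fun x _ => hXnn x)
    linarith
  have hX0 : ∀ x, (τ₀ x + 8 * v x) ^ 2 - τ₀ x ^ 2 = 0 := fun x =>
    (sum_eq_zero_iff_of_nonneg fun y _ => hXnn y).1 hXsum0 x (mem_univ x)
  intro x
  have hv0 : v x = 0 := by
    by_contra hne
    have h1 : 1 ≤ v x ∨ v x ≤ -1 := by omega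
    have h2 := to12_excess _ _ 1 (hτ₀val x) le_rfl h1
    have h3 := hX0 x
    linarith
  rw [hv x, hv0]; ring

/-! ### The partner of a base-`992` type-O side is a level-5 side, hence no type-O side at `Φ ≥ 930/1024` -/

/-- **The partner is a level-5 side.**  For cubic `f, g` on 12 bits with `W_g = 16u`, some `u` odd, `Φ(f,g) ≥ 930/1024`, and `W_f = 16u_f`:
every `u_f(y)` is even, and `u_f(c₁)/2` is odd at the point `c₁` carrying the affine digit `d₁`. [this work] -/
theorem to20_typeO_930_partner (f g : (Fin (6 + 6) → Bool) → Bool) (hf : IsDegLeFun 3 f) (hg : IsDegLeFun 3 g)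
    (u : (Fin (6 + 6) → Bool) → ℤ) (hu : ∀ x, W (fun y => signOf (g y)) x = (2 : ℝ) ^ 4 * (u x : ℝ))
    (hodd : ∃ x, Odd (u x)) (hΦ : (930 / 1024 : ℝ) ≤ forrelation f g)
    (uf : (Fin (6 + 6) → Bool) → ℤ) (huf : ∀ y, W (fun x => signOf (f x)) y = (2 : ℝ) ^ 4 * (uf y : ℝ)) :
    (∀ y, ¬ Odd (uf y)) ∧ ∃ c₁, Odd (uf c₁ / 2) := by
  classical
  have hall : ∀ x, Odd (u x) := TypeOTwelve.typeO_of_exists_odd g u hg hu hodd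
  have hu' : ∀ x, W (fun y => signOf (g y)) x = (2 : ℝ) ^ (2 * 2) * (u x : ℝ) := fun x => (hu x).trans (by norm_num)
  have hd1 : IsDegLeFun 1 (fun x => decide (Odd (u x / 2))) := z2_digitOne 2 g u hg hu' hall
  have hd2 : IsDegLeFun 3 (fun x => decide (Odd (u x / 2 / 2))) := z2_digitTwo 2 g u hg hu' hall
  obtain ⟨c₁, b₁, hcb⟩ := stub_affineForm (6 + 6) _ hd1
  set E := univ.filter (fun x : Fin (6 + 6) → Bool => (Odd (u x / 2) ↔ Odd (u x / 2 / 2))) with hEdef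
  obtain ⟨hE, hT, -⟩ := to19_typeO_ge930_shape f g hf hg u hu hodd hΦ
  -- the base set is a cubic support with `992` points
  have hdegE : IsDegLeFun (2 + 1) (fun x => (decide (Odd (u x / 2)) ^^ decide (Odd (u x / 2 / 2))) ^^ true) :=
    tb_isDegLeFun_xor_const (bb_isDegLeFun_bxor (hd1.mono (by norm_num)) hd2) true
  have hsetE : (univ.filter fun x : Fin (6 + 6) → Bool =>
      ((decide (Odd (u x / 2)) ^^ decide (Odd (u x / 2 / 2))) ^^ true) = true) = E := by
    rw [hEdef]
    apply filter_congr
    intro x _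
    by_cases h1 : Odd (u x / 2) <;> by_cases h2 : Odd (u x / 2 / 2) <;> simp [h1, h2]
  -- zero excess: `v = 0` in the partner identity
  have hτ := to20_typeO_E992_zero_excess f g hg u hu hodd (by rw [← hEdef]; exact hE) hT
  have hv : ∀ x, u x - 4 * sZ (f x) =
      sZ (decide (Odd (u x / 2))) * (1 - 4 * (if (Odd (u x / 2) ↔ Odd (u x / 2 / 2)) then 1 else 0)) + 8 * (fun _ => (0 : ℤ)) x := by
    intro x; rw [hτ x]; ring
  have hid : ∀ y, 64 * (uf y : ℝ) = 256 * signOf (g y) -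
      signOf b₁ * ((if bxor c₁ y = (fun _ => false) then (2 : ℝ) ^ (6 + 6) else 0) - 4 * ∑ x ∈ E, twist x (bxor c₁ y)) := by
    intro y
    have h := to18_typeO_partner_identity f g u hu (fun _ => (0 : ℤ)) hv c₁ b₁ hcb uf huf y
    rw [← hEdef] at h
    have h0 : ∑ x : Fin (6 + 6) → Bool, (((fun _ => (0 : ℤ)) x : ℤ) : ℝ) * twist x y = 0 := by simp
    rw [h0, mul_zero, sub_zero] at h
    exact h
  have hsb : signOf b₁ = 1 ∨ signOf b₁ = -1 := by cases b₁ <;> simp [signOf]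
  have hsb' : ((sZ b₁ : ℤ) : ℝ) = signOf b₁ := tp_sZ_cast _
  -- at `y = c₁`: `Ê(0) = 992`, `u_f = 4(−1)^g − 2(−1)^{b₁}`
  have hc₁ : uf c₁ = 4 * sZ (g c₁) - 2 * sZ b₁ := by
    have h := hid c₁
    have hz : bxor c₁ c₁ = (fun _ => false) := bxor_self c₁
    rw [if_pos hz] at h
    have hS : ∑ x ∈ E, twist x (bxor c₁ c₁) = 992 := by
      rw [hz, show (fun _ : Fin (6 + 6) => false) = (zeroVec : Fin (6 + 6) → Bool) from rfl,
        sum_congr rfl fun x _ => twist_zeroVec_right x, sum_const]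
      rw [show #E = 992 from hE]; norm_num
    rw [hS] at h
    have h' : (uf c₁ : ℝ) = 4 * signOf (g c₁) - 2 * signOf b₁ := by
      have e128 : ((2 : ℝ) ^ (6 + 6) - 4 * 992) = 128 := by norm_num
      rw [e128] at h; linarith
    have e : ((uf c₁ : ℤ) : ℝ) = ((4 * sZ (g c₁) - 2 * sZ b₁ : ℤ) : ℝ) := by push_cast; rw [tp_sZ_cast, hsb']; exact h'
    exact_mod_cast e
  refine ⟨fun y => ?_, ⟨c₁, ?_⟩⟩
  · -- `u_f(y)` is even
    by_cases hz : bxor c₁ y = (fun _ => false)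
    · have hy : y = c₁ := by
        have := congrArg (bxor c₁) hz
        rw [bxor_bxor_cancel_left] at this
        rw [this]; exact bxor_zeroVec c₁
      rw [hy, hc₁]
      intro hodd'
      rcases tp_sZ_cases (g c₁) with h1 | h1 <;> rcases tp_sZ_cases b₁ with h2 | h2 <;> rw [h1, h2] at hodd' <;> revert hodd' <;> decide
    · have h := hid y
      rw [if_neg hz] at h
      obtain ⟨i₀, hi₀⟩ : ∃ i₀, bxor c₁ y i₀ = true := by
        by_contra hn
        push Not at hn
        exact hz (funext fun i => by simpa using hn i)
      obtain ⟨m, hm⟩ := to20_char_sum_E992 _ hdegE (by rw [hsetE]; exact hE) (bxor c₁ y) i₀ hi₀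
      rw [hsetE] at hm
      rw [hm] at h
      have h' : (uf y : ℝ) = 4 * signOf (g y) + 2 * signOf b₁ * m := by linarith
      have hZ : uf y = 4 * sZ (g y) + 2 * sZ b₁ * m := by
        have e : ((uf y : ℤ) : ℝ) = ((4 * sZ (g y) + 2 * sZ b₁ * m : ℤ) : ℝ) := by push_cast; rw [tp_sZ_cast, hsb']; exact h'
        exact_mod_cast e
      rw [hZ]
      intro hodd'
      exact (Int.not_even_iff_odd.2 hodd') ⟨2 * sZ (g y) + sZ b₁ * m, by ring⟩
  · -- `u_f(c₁)/2 = 2(−1)^g − (−1)^{b₁}` is odd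
    rw [hc₁]
    rcases tp_sZ_cases (g c₁) with h1 | h1 <;> rcases tp_sZ_cases b₁ with h2 | h2 <;> rw [h1, h2] <;> decide

/-- **No type-O side at `Φ ≥ 930/1024` on 12 bits.**  See the module docstring.  Finite-slice statement, NOT summit progress. [this work] -/
theorem to20_typeO_ge930_false (f g : (Fin (6 + 6) → Bool) → Bool) (hf : IsDegLeFun 3 f) (hg : IsDegLeFun 3 g)
    (u : (Fin (6 + 6) → Bool) → ℤ) (hu : ∀ x, W (fun y => signOf (g y)) x = (2 : ℝ) ^ 4 * (u x : ℝ))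
    (hodd : ∃ x, Odd (u x)) (hΦ : (930 / 1024 : ℝ) ≤ forrelation f g) : False := by
  obtain ⟨uf, huf⟩ := tw_base (n := 6 + 6) f hf 4 (by norm_num)
  obtain ⟨hev, c₁, hc₁⟩ := to20_typeO_930_partner f g hf hg u hu hodd hΦ uf huf
  have huf5 := tw_level_up (j := 4) f uf huf hev
  have hΦ' : forrelation g f = forrelation f g := by
    rw [Summit.QuantumAdvantage.QuantumAdvantage.Theorems.SignedCubicForrelationNotPrBPP.Negative.HalfQuad.forrelation_comm]
  exact tw20_levelFive_ge930_false g f hg hf (fun y => uf y / 2) huf5 ⟨c₁, hc₁⟩ (by rw [hΦ']; exact hΦ)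

/-- **Packaging at `Fin 12`.** [this work] -/
theorem typeO_ge_930_false_twelve : ∀ f g : (Fin 12 → Bool) → Bool, IsDegLeFun 3 f → IsDegLeFun 3 g →
    ∀ u : (Fin 12 → Bool) → ℤ, (∀ x, W (fun y => signOf (g y)) x = 16 * (u x : ℝ)) → (∃ x, Odd (u x)) →
    (930 / 1024 : ℝ) ≤ forrelation f g → False :=
  fun f g hf hg u hu hodd hΦ => to20_typeO_ge930_false f g hf hg u (fun x => (hu x).trans (by norm_num)) hodd hΦ

end Summit.QuantumAdvantage.QuantumAdvantage.Theorems.CubicForrelation.NearExactIsExact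

end
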